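import Summits.BirchSwinnertonDyer.BirchSwinnertonDyer.Theorems.KolyvaginDepthDoorDepthTableKuriharaDecisiveTuple
import HarnessLib

/-!
# Route `KolyvaginDepthDoor`, crux `KolyvaginDepthSupplyKN` (stmt-BirchSwinnertonDyer-22820) —
# DEPTH TABLE v23, RANK THREE: «THE DECISIVE TRIPLE» — the KERNEL BRIDGE for a combination `a•P₁ + b•P₂ + c•P₃`
# (local `p`-indivisibility in `E(ℚ_q)` from `decide`-checked chains and two chords in `Ẽ(𝔽_q)`) and the E-SIDE of a
# rank-three row TWO-WAY AT A PRESCRIBED cyclic level `n = ℓ₁ℓ₂ℓ₃` («`Ш(E/ℚ)[p] = 0 ⟺ δ̃_n(E)` is a unit»)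

Helper file of the lead prover of line `levelone` (kdd-p1 g27; `--supports stmt-BirchSwinnertonDyer-22820
--as helper`); it closes nothing and BSD is NOT proved by it.

The generic depth-`r` theorem `sha_inf_torsionBy_eq_bot_iff_kuriharaClaim_of_rank` and the reduction
`localWitness₃_of_representatives` to the `p² + p + 1` projective representatives `(0,0,1)`, `(0,1,t)`, `(1,s,t)`
live in the sibling `…KuriharaDecisiveTuple`. Here: §1 `localNondivisible_combo₃_of_chains` — the v22 bridge
`localNondivisible_combo_of_chains` (g26) with a third point and a second chord certificate; §2
`sha_inf_torsionBy_eq_bot_iff_kuriharaClaim_triple` — at `rank_ℤ E(ℚ) = 3`, «`Ш(E/ℚ)[p] = 0` ⟺ the claim at the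
prescribed triple» from the seven families `h001 … h1st` of local certificates (the per-curve files discharge them
by `decide`-checked chains: `…KuriharaDecisiveTriple5077a1`, `p = 7`, `n = 113·211·463`).

CONDITIONAL on the named facts displayed as hypotheses (`hSakR`; `hKim`, `hnf`, `hMaz` for `⟸`); per
`(W, p, ℓ₁, ℓ₂, ℓ₃)`; nothing class-wide (the open stub (S♭) is untouched); BSD is NOT proved by any of this.

References: [Sakamoto2022pSelmer] Doc. Math. 27 (2022) = arXiv:2106.03370, Lemma 4.4, Rem. 4.5, Lemma 4.6 (1);
[Kurihara2014] arXiv:1407.2465, §5.3 example (8); [Kim2022StructureSelmer] Thm. 1.11; [SilvermanAEC2009] III.2.3,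
VII.2.1, VII.3.1, X.4.2.
-/

set_option linter.dupNamespace false

noncomputable section

open scoped Classical NumberField

namespace Summit.BirchSwinnertonDyer.BirchSwinnertonDyer.Theorems.KolyvaginDepthDoor

open Literature.NumberTheory.EllipticCurves Literature.NumberTheory.EllipticCurves.ModularForms
  WeierstrassCurve NumberField IsDedekindDomain
open Summit.BirchSwinnertonDyer.BirchSwinnertonDyer.Theorems
open Summit.BirchSwinnertonDyer.BirchSwinnertonDyer.Rank2Observatory

/-! ## §1 KERNEL BRIDGE for a triple combination `a•P₁ + b•P₂ + c•P₃` -/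

section Bridge

variable (V : WeierstrassCurve ℤ) (q : ℕ) [Fact q.Prime]

/-- **KERNEL BRIDGE for a combination `a•P₁ + b•P₂ + c•P₃`** (rational points, denominators prime to
`q ∤ Δ(V)`, `p·k = #Ẽ(𝔽_q)`): `decide`-able DATA — chains for `a•P̄₁`, `b•P̄₂`, `c•P̄₃` (`a = chainMult 1 stepsA`,
…), a CHORD certificate for `a•P̄₁ + b•P̄₂ = (x₁₂, y₁₂)`, a CHORD certificate for `(x₁₂, y₁₂) + c•P̄₃ = (xS, yS)` and a
chain from `(xS, yS)` reaching `k` — give `k • (a•P̄₁ + b•P̄₂ + c•P̄₃) ≠ O`, hence `p • Q ≠ a•P₁ + b•P₂ + c•P₃` in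
`E(ℚ_q)` (reduction and base change are homomorphisms; v22's `localNondivisible_of_nsmul_reduceMod_ne_zero`).
[cite: SilvermanAEC2009, III.2.3, VII.2 Prop. 2.1, VII.3 Prop. 3.1] -/
theorem localNondivisible_combo₃_of_chains (hq : ¬ (q : ℤ) ∣ V.Δ) {x₁ y₁ x₂ y₂ x₃ y₃ : ℚ}
    (h₁ : (V.map (Int.castRingHom ℚ)).toAffine.Nonsingular x₁ y₁)
    (h₂ : (V.map (Int.castRingHom ℚ)).toAffine.Nonsingular x₂ y₂)
    (h₃ : (V.map (Int.castRingHom ℚ)).toAffine.Nonsingular x₃ y₃)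
    (hx₁ : ¬ q ∣ x₁.den) (hy₁ : ¬ q ∣ y₁.den) (hx₂ : ¬ q ∣ x₂.den) (hy₂ : ¬ q ∣ y₂.den)
    (hx₃ : ¬ q ∣ x₃.den) (hy₃ : ¬ q ∣ y₃.den)
    {m₁ m₁' m₂ m₂' m₃ m₃' : ℤ} (hm₁ : (q : ℤ) ∣ x₁.num - m₁ * x₁.den) (hm₁' : (q : ℤ) ∣ y₁.num - m₁' * y₁.den)
    (hm₂ : (q : ℤ) ∣ x₂.num - m₂ * x₂.den) (hm₂' : (q : ℤ) ∣ y₂.num - m₂' * y₂.den)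
    (hm₃ : (q : ℤ) ∣ x₃.num - m₃ * x₃.den) (hm₃' : (q : ℤ) ∣ y₃.num - m₃' * y₃.den)
    {p k : ℕ} (hpk : p * k = Nat.card (V.map (Int.castRingHom (ZMod q))).toAffine.Point)
    {a b c : ℕ} {stepsA stepsB stepsC stepsK : List (Bool × ZMod q × ZMod q)}
    (hA : chainB V q (m₁ : ZMod q) (m₁' : ZMod q) ((m₁ : ZMod q), (m₁' : ZMod q)) stepsA = true)
    (hmA : chainMult 1 stepsA = a)
    (hB : chainB V q (m₂ : ZMod q) (m₂' : ZMod q) ((m₂ : ZMod q), (m₂' : ZMod q)) stepsB = true)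
    (hmB : chainMult 1 stepsB = b)
    (hC : chainB V q (m₃ : ZMod q) (m₃' : ZMod q) ((m₃ : ZMod q), (m₃' : ZMod q)) stepsC = true)
    (hmC : chainMult 1 stepsC = c)
    {x₁₂ y₁₂ xS yS : ZMod q}
    (hC₁ : zmodChord V q (chainLast ((m₁ : ZMod q), (m₁' : ZMod q)) stepsA).1
        (chainLast ((m₁ : ZMod q), (m₁' : ZMod q)) stepsA).2
        (chainLast ((m₂ : ZMod q), (m₂' : ZMod q)) stepsB).1
        (chainLast ((m₂ : ZMod q), (m₂' : ZMod q)) stepsB).2 x₁₂ y₁₂ = true)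
    (hC₂ : zmodChord V q x₁₂ y₁₂ (chainLast ((m₃ : ZMod q), (m₃' : ZMod q)) stepsC).1
        (chainLast ((m₃ : ZMod q), (m₃' : ZMod q)) stepsC).2 xS yS = true)
    (hK : chainB V q xS yS (xS, yS) stepsK = true) (hmK : chainMult 1 stepsK = k) :
    ∀ Q : ((V.map (Int.castRingHom ℚ)).baseChange ℚ_[q]).toAffine.Point,
      p • Q ≠ a • WeierstrassCurve.Affine.Point.map (W' := (V.map (Int.castRingHom ℚ)).toAffine) (S := ℚ)
          (Algebra.ofId ℚ ℚ_[q]) (Affine.Point.some x₁ y₁ h₁) +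
        b • WeierstrassCurve.Affine.Point.map (W' := (V.map (Int.castRingHom ℚ)).toAffine) (S := ℚ)
          (Algebra.ofId ℚ ℚ_[q]) (Affine.Point.some x₂ y₂ h₂) +
        c • WeierstrassCurve.Affine.Point.map (W' := (V.map (Int.castRingHom ℚ)).toAffine) (S := ℚ)
          (Algebra.ofId ℚ ℚ_[q]) (Affine.Point.some x₃ y₃ h₃) := by
  -- the reductions of `P₁`, `P₂`, `P₃`
  obtain ⟨h₁', e₁⟩ := reduceMod_some_rat V q hq h₁ hx₁ hy₁ hm₁ hm₁'
  obtain ⟨h₂', e₂⟩ := reduceMod_some_rat V q hq h₂ hx₂ hy₂ hm₂ hm₂'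
  obtain ⟨h₃', e₃⟩ := reduceMod_some_rat V q hq h₃ hx₃ hy₃ hm₃ hm₃'
  -- `a • P̄₁`, `b • P̄₂`, `c • P̄₃` from the three chains
  obtain ⟨hA', eA⟩ := exists_nsmul_eq_some_of_chainB V q h₁' stepsA ((m₁ : ZMod q), (m₁' : ZMod q)) 1 h₁'
    (one_nsmul _) hA
  obtain ⟨hB', eB⟩ := exists_nsmul_eq_some_of_chainB V q h₂' stepsB ((m₂ : ZMod q), (m₂' : ZMod q)) 1 h₂'
    (one_nsmul _) hB
  obtain ⟨hC', eC⟩ := exists_nsmul_eq_some_of_chainB V q h₃' stepsC ((m₃ : ZMod q), (m₃' : ZMod q)) 1 h₃'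
    (one_nsmul _) hC
  rw [hmA] at eA; rw [hmB] at eB; rw [hmC] at eC
  -- the two chords, and `k •` the sum is an affine point
  obtain ⟨h₁₂', e₁₂⟩ := exists_some_add_some_of_zmodChord V q hA' hB' hC₁
  obtain ⟨hS', eS⟩ := exists_some_add_some_of_zmodChord V q h₁₂' hC' hC₂
  have hneK := nsmul_ne_zero_of_chainB V q hS' hK
  rw [hmK] at hneK
  have hgen := localNondivisible_of_nsmul_reduceMod_ne_zero V q hq
    (a • Affine.Point.some x₁ y₁ h₁ + b • Affine.Point.some x₂ y₂ h₂ + c • Affine.Point.some x₃ y₃ h₃) hpk (by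
      rw [map_add, map_add, map_nsmul, map_nsmul, map_nsmul, e₁, e₂, e₃, eA, eB, eC, e₁₂, eS]
      exact hneK)
  intro Q hQ
  rw [← map_nsmul, ← map_nsmul, ← map_nsmul, ← map_add, ← map_add] at hQ
  exact hgen Q hQ

end Bridge

/-! ## §2 Depth three in tree vocabulary: the E-side two-way at a prescribed `n = ℓ₁ℓ₂ℓ₃` -/

/-- **E-SIDE, EXACTLY, AT THE PRESCRIBED TRIPLE: at `rank_ℤ E(ℚ) = 3`, `Ш(E/ℚ)[p] = 0` ⟺ a unit mod-`p` Kurihara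
number of `E` AT THE LEVEL `n = ℓ₁ℓ₂ℓ₃` (for every admissible datum)**, granted the kernel certificate that the
localisation matrix of `P₁, P₂, P₃ ∈ E(ℚ)` at `(ℓ₁, ℓ₂, ℓ₃)` is invertible mod `p`, delivered as the seven families
`h001 … h1st` of local `p`-indivisibilities of the `p² + p + 1` projective representatives (each in one of
`E(ℚ_{ℓ₁})`, `E(ℚ_{ℓ₂})`, `E(ℚ_{ℓ₃})`; §2 supplies the other combinations, §1 the two directions). CONDITIONAL on `hKim`,
`hnf`, `hMaz`, `hSakR`; per curve; BSD is not proved by it. [cite: Sakamoto2022pSelmer, Lemma 4.4, Lemma 4.6 (1)]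
[cite: Kim2022StructureSelmer, Thm. 1.11] [cite: Kurihara2014, §5.3 example (8)] -/
theorem sha_inf_torsionBy_eq_bot_iff_kuriharaClaim_triple
    (hKim : Kim2022_card_selmerGroup_le_pow_of_kuriharaNumber_ne_zero) (hnf : exists_isNewformOf)
    (hMaz : mazur_not_dvd_maninConstant_of_odd)
    (hSakR : Literature.NumberTheory.EllipticCurves.Sakamoto2022_kuriharaNumber_ne_zero_of_localizationInjective)
    (W : WeierstrassCurve ℚ) [W.IsElliptic] [W.IsGloballyMinimal] (p : ℕ) [hp : Fact p.Prime] (h5 : 5 ≤ p)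
    (hgood : W.HasGoodReductionAtPrime p) (hord : ¬ (p : ℤ) ∣ W.frobeniusTrace p)
    (hsur : W.HasSurjectiveModNGaloisRep p) (hna : ¬ (p : ℤ) ∣ W.frobeniusTrace p - 1)
    (hKN : ∀ v : HeightOneSpectrum (𝓞 ℚ), W.HasMultiplicativeReductionAt v → ¬ p ∣ W.ordMinimalDiscriminant v)
    [iNZ : NeZero (W.conductorNorm ℤ)] (hrank : W.mordellWeilRank = 3)
    (ℓ₁ ℓ₂ ℓ₃ n : ℕ) [hℓ₁ : Fact ℓ₁.Prime] [hℓ₂ : Fact ℓ₂.Prime] [hℓ₃ : Fact ℓ₃.Prime]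
    (h12 : ℓ₁ ≠ ℓ₂) (h13 : ℓ₁ ≠ ℓ₃) (h23 : ℓ₂ ≠ ℓ₃) (hnl : ℓ₁ * ℓ₂ * ℓ₃ = n)
    [NeZero n] (hn : IsCyclicKolyvaginLevel W p n)
    (P₁ P₂ P₃ : W.toAffine.Point)
    (h001 : (∀ Q : (W.baseChange ℚ_[ℓ₁]).toAffine.Point,
        p • Q ≠ WeierstrassCurve.Affine.Point.map (W' := W.toAffine) (S := ℚ) (Algebra.ofId ℚ ℚ_[ℓ₁]) P₃) ∨
      (∀ Q : (W.baseChange ℚ_[ℓ₂]).toAffine.Point,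
        p • Q ≠ WeierstrassCurve.Affine.Point.map (W' := W.toAffine) (S := ℚ) (Algebra.ofId ℚ ℚ_[ℓ₂]) P₃) ∨
      (∀ Q : (W.baseChange ℚ_[ℓ₃]).toAffine.Point,
        p • Q ≠ WeierstrassCurve.Affine.Point.map (W' := W.toAffine) (S := ℚ) (Algebra.ofId ℚ ℚ_[ℓ₃]) P₃))
    (h010 : (∀ Q : (W.baseChange ℚ_[ℓ₁]).toAffine.Point,
        p • Q ≠ WeierstrassCurve.Affine.Point.map (W' := W.toAffine) (S := ℚ) (Algebra.ofId ℚ ℚ_[ℓ₁]) P₂) ∨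
      (∀ Q : (W.baseChange ℚ_[ℓ₂]).toAffine.Point,
        p • Q ≠ WeierstrassCurve.Affine.Point.map (W' := W.toAffine) (S := ℚ) (Algebra.ofId ℚ ℚ_[ℓ₂]) P₂) ∨
      (∀ Q : (W.baseChange ℚ_[ℓ₃]).toAffine.Point,
        p • Q ≠ WeierstrassCurve.Affine.Point.map (W' := W.toAffine) (S := ℚ) (Algebra.ofId ℚ ℚ_[ℓ₃]) P₂))
    (h100 : (∀ Q : (W.baseChange ℚ_[ℓ₁]).toAffine.Point,
        p • Q ≠ WeierstrassCurve.Affine.Point.map (W' := W.toAffine) (S := ℚ) (Algebra.ofId ℚ ℚ_[ℓ₁]) P₁) ∨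
      (∀ Q : (W.baseChange ℚ_[ℓ₂]).toAffine.Point,
        p • Q ≠ WeierstrassCurve.Affine.Point.map (W' := W.toAffine) (S := ℚ) (Algebra.ofId ℚ ℚ_[ℓ₂]) P₁) ∨
      (∀ Q : (W.baseChange ℚ_[ℓ₃]).toAffine.Point,
        p • Q ≠ WeierstrassCurve.Affine.Point.map (W' := W.toAffine) (S := ℚ) (Algebra.ofId ℚ ℚ_[ℓ₃]) P₁))
    (h01t : ∀ t, 1 ≤ t → t < p →
      (∀ Q : (W.baseChange ℚ_[ℓ₁]).toAffine.Point,
        p • Q ≠ 1 • WeierstrassCurve.Affine.Point.map (W' := W.toAffine) (S := ℚ) (Algebra.ofId ℚ ℚ_[ℓ₁]) P₂ +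
          t • WeierstrassCurve.Affine.Point.map (W' := W.toAffine) (S := ℚ) (Algebra.ofId ℚ ℚ_[ℓ₁]) P₃) ∨
      (∀ Q : (W.baseChange ℚ_[ℓ₂]).toAffine.Point,
        p • Q ≠ 1 • WeierstrassCurve.Affine.Point.map (W' := W.toAffine) (S := ℚ) (Algebra.ofId ℚ ℚ_[ℓ₂]) P₂ +
          t • WeierstrassCurve.Affine.Point.map (W' := W.toAffine) (S := ℚ) (Algebra.ofId ℚ ℚ_[ℓ₂]) P₃) ∨
      (∀ Q : (W.baseChange ℚ_[ℓ₃]).toAffine.Point,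
        p • Q ≠ 1 • WeierstrassCurve.Affine.Point.map (W' := W.toAffine) (S := ℚ) (Algebra.ofId ℚ ℚ_[ℓ₃]) P₂ +
          t • WeierstrassCurve.Affine.Point.map (W' := W.toAffine) (S := ℚ) (Algebra.ofId ℚ ℚ_[ℓ₃]) P₃))
    (h1s0 : ∀ s, 1 ≤ s → s < p →
      (∀ Q : (W.baseChange ℚ_[ℓ₁]).toAffine.Point,
        p • Q ≠ 1 • WeierstrassCurve.Affine.Point.map (W' := W.toAffine) (S := ℚ) (Algebra.ofId ℚ ℚ_[ℓ₁]) P₁ +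
          s • WeierstrassCurve.Affine.Point.map (W' := W.toAffine) (S := ℚ) (Algebra.ofId ℚ ℚ_[ℓ₁]) P₂) ∨
      (∀ Q : (W.baseChange ℚ_[ℓ₂]).toAffine.Point,
        p • Q ≠ 1 • WeierstrassCurve.Affine.Point.map (W' := W.toAffine) (S := ℚ) (Algebra.ofId ℚ ℚ_[ℓ₂]) P₁ +
          s • WeierstrassCurve.Affine.Point.map (W' := W.toAffine) (S := ℚ) (Algebra.ofId ℚ ℚ_[ℓ₂]) P₂) ∨
      (∀ Q : (W.baseChange ℚ_[ℓ₃]).toAffine.Point,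
        p • Q ≠ 1 • WeierstrassCurve.Affine.Point.map (W' := W.toAffine) (S := ℚ) (Algebra.ofId ℚ ℚ_[ℓ₃]) P₁ +
          s • WeierstrassCurve.Affine.Point.map (W' := W.toAffine) (S := ℚ) (Algebra.ofId ℚ ℚ_[ℓ₃]) P₂))
    (h10t : ∀ t, 1 ≤ t → t < p →
      (∀ Q : (W.baseChange ℚ_[ℓ₁]).toAffine.Point,
        p • Q ≠ 1 • WeierstrassCurve.Affine.Point.map (W' := W.toAffine) (S := ℚ) (Algebra.ofId ℚ ℚ_[ℓ₁]) P₁ +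
          t • WeierstrassCurve.Affine.Point.map (W' := W.toAffine) (S := ℚ) (Algebra.ofId ℚ ℚ_[ℓ₁]) P₃) ∨
      (∀ Q : (W.baseChange ℚ_[ℓ₂]).toAffine.Point,
        p • Q ≠ 1 • WeierstrassCurve.Affine.Point.map (W' := W.toAffine) (S := ℚ) (Algebra.ofId ℚ ℚ_[ℓ₂]) P₁ +
          t • WeierstrassCurve.Affine.Point.map (W' := W.toAffine) (S := ℚ) (Algebra.ofId ℚ ℚ_[ℓ₂]) P₃) ∨
      (∀ Q : (W.baseChange ℚ_[ℓ₃]).toAffine.Point,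
        p • Q ≠ 1 • WeierstrassCurve.Affine.Point.map (W' := W.toAffine) (S := ℚ) (Algebra.ofId ℚ ℚ_[ℓ₃]) P₁ +
          t • WeierstrassCurve.Affine.Point.map (W' := W.toAffine) (S := ℚ) (Algebra.ofId ℚ ℚ_[ℓ₃]) P₃))
    (h1st : ∀ s t, 1 ≤ s → s < p → 1 ≤ t → t < p →
      (∀ Q : (W.baseChange ℚ_[ℓ₁]).toAffine.Point,
        p • Q ≠ 1 • WeierstrassCurve.Affine.Point.map (W' := W.toAffine) (S := ℚ) (Algebra.ofId ℚ ℚ_[ℓ₁]) P₁ +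
          s • WeierstrassCurve.Affine.Point.map (W' := W.toAffine) (S := ℚ) (Algebra.ofId ℚ ℚ_[ℓ₁]) P₂ +
          t • WeierstrassCurve.Affine.Point.map (W' := W.toAffine) (S := ℚ) (Algebra.ofId ℚ ℚ_[ℓ₁]) P₃) ∨
      (∀ Q : (W.baseChange ℚ_[ℓ₂]).toAffine.Point,
        p • Q ≠ 1 • WeierstrassCurve.Affine.Point.map (W' := W.toAffine) (S := ℚ) (Algebra.ofId ℚ ℚ_[ℓ₂]) P₁ +
          s • WeierstrassCurve.Affine.Point.map (W' := W.toAffine) (S := ℚ) (Algebra.ofId ℚ ℚ_[ℓ₂]) P₂ +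
          t • WeierstrassCurve.Affine.Point.map (W' := W.toAffine) (S := ℚ) (Algebra.ofId ℚ ℚ_[ℓ₂]) P₃) ∨
      (∀ Q : (W.baseChange ℚ_[ℓ₃]).toAffine.Point,
        p • Q ≠ 1 • WeierstrassCurve.Affine.Point.map (W' := W.toAffine) (S := ℚ) (Algebra.ofId ℚ ℚ_[ℓ₃]) P₁ +
          s • WeierstrassCurve.Affine.Point.map (W' := W.toAffine) (S := ℚ) (Algebra.ofId ℚ ℚ_[ℓ₃]) P₂ +
          t • WeierstrassCurve.Affine.Point.map (W' := W.toAffine) (S := ℚ) (Algebra.ofId ℚ ℚ_[ℓ₃]) P₃)) :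
    (W.sha ⊓ AddSubgroup.torsionBy W.galH1 (p : ℤ) : AddSubgroup W.galH1) = ⊥ ↔
      ∀ (D : ModularParametrizationData W (W.conductorNorm ℤ)), ¬ (p : ℤ) ∣ D.maninConstant →
        (∃ u : ℚ, ‖(u : ℚ_[p])‖ = 1 ∧ W.realPeriodRat = u * plusPeriod D.f) →
        ∃ ψ : (q : ℕ) → (ZMod q)ˣ →* Multiplicative (ZMod p),
          (∀ q ∈ n.primeFactors, Function.Surjective (ψ q)) ∧ kuriharaNumber D.f p n ψ ≠ 0 := by
  have hℓ₁P : ℓ₁.Prime := hℓ₁.out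
  have hℓ₂P : ℓ₂.Prime := hℓ₂.out
  have hℓ₃P : ℓ₃.Prime := hℓ₃.out
  have hpf : n.primeFactors = {ℓ₁, ℓ₂, ℓ₃} := by
    rw [← hnl, Nat.primeFactors_mul (mul_ne_zero hℓ₁P.ne_zero hℓ₂P.ne_zero) hℓ₃P.ne_zero,
      Nat.primeFactors_mul hℓ₁P.ne_zero hℓ₂P.ne_zero, hℓ₁P.primeFactors, hℓ₂P.primeFactors, hℓ₃P.primeFactors]
    ext x
    simp only [Finset.mem_union, Finset.mem_singleton, Finset.mem_insert, or_assoc]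
  have hcard : n.primeFactors.card = 3 := by
    rw [hpf, Finset.card_insert_of_notMem (by simp [h12, h13]), Finset.card_pair h23]
  have hm₁ : ℓ₁ ∈ n.primeFactors := by rw [hpf]; simp
  have hm₂ : ℓ₂ ∈ n.primeFactors := by rw [hpf]; simp
  have hm₃ : ℓ₃ ∈ n.primeFactors := by rw [hpf]; simp
  have hall := localWitness₃_of_representatives p
    (WeierstrassCurve.Affine.Point.map (W' := W.toAffine) (S := ℚ) (Algebra.ofId ℚ ℚ_[ℓ₁]) P₁)
    (WeierstrassCurve.Affine.Point.map (W' := W.toAffine) (S := ℚ) (Algebra.ofId ℚ ℚ_[ℓ₁]) P₂)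
    (WeierstrassCurve.Affine.Point.map (W' := W.toAffine) (S := ℚ) (Algebra.ofId ℚ ℚ_[ℓ₁]) P₃)
    (WeierstrassCurve.Affine.Point.map (W' := W.toAffine) (S := ℚ) (Algebra.ofId ℚ ℚ_[ℓ₂]) P₁)
    (WeierstrassCurve.Affine.Point.map (W' := W.toAffine) (S := ℚ) (Algebra.ofId ℚ ℚ_[ℓ₂]) P₂)
    (WeierstrassCurve.Affine.Point.map (W' := W.toAffine) (S := ℚ) (Algebra.ofId ℚ ℚ_[ℓ₂]) P₃)
    (WeierstrassCurve.Affine.Point.map (W' := W.toAffine) (S := ℚ) (Algebra.ofId ℚ ℚ_[ℓ₃]) P₁)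
    (WeierstrassCurve.Affine.Point.map (W' := W.toAffine) (S := ℚ) (Algebra.ofId ℚ ℚ_[ℓ₃]) P₂)
    (WeierstrassCurve.Affine.Point.map (W' := W.toAffine) (S := ℚ) (Algebra.ofId ℚ ℚ_[ℓ₃]) P₃)
    h001 h010 h100 h01t h1s0 h10t h1st
  -- the sum over `Fin 3` of the tuple `![P₁, P₂, P₃]`
  have hsum : ∀ (ℓ : ℕ) [Fact ℓ.Prime] (a : Fin 3 → ℕ),
      ∑ i, a i • WeierstrassCurve.Affine.Point.map (W' := W.toAffine) (S := ℚ) (Algebra.ofId ℚ ℚ_[ℓ])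
          ((![P₁, P₂, P₃] : Fin 3 → W.toAffine.Point) i) =
        a 0 • WeierstrassCurve.Affine.Point.map (W' := W.toAffine) (S := ℚ) (Algebra.ofId ℚ ℚ_[ℓ]) P₁ +
          a 1 • WeierstrassCurve.Affine.Point.map (W' := W.toAffine) (S := ℚ) (Algebra.ofId ℚ ℚ_[ℓ]) P₂ +
          a 2 • WeierstrassCurve.Affine.Point.map (W' := W.toAffine) (S := ℚ) (Algebra.ofId ℚ ℚ_[ℓ]) P₃ := by
    intro ℓ _ a
    rw [Fin.sum_univ_three]
    simp only [Matrix.cons_val_zero, Matrix.cons_val_one, Matrix.cons_val_two, Matrix.head_cons,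
      Matrix.tail_cons]
  refine sha_inf_torsionBy_eq_bot_iff_kuriharaClaim_of_rank hKim hnf hMaz hSakR W p h5 hgood hord hsur hna hKN 3 hrank
    n hn hcard ![P₁, P₂, P₃] ?_
  intro a ha
  have habc : ¬ (p ∣ a 0 ∧ p ∣ a 1 ∧ p ∣ a 2) := by
    obtain ⟨i, hi⟩ := ha
    fin_cases i
    · exact fun h ↦ hi h.1
    · exact fun h ↦ hi h.2.1
    · exact fun h ↦ hi h.2.2
  rcases hall (a 0) (a 1) (a 2) habc with h | h | h
  · exact ⟨ℓ₁, hℓ₁, hm₁, fun Q hQ ↦ h Q (hQ.trans (hsum ℓ₁ a))⟩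
  · exact ⟨ℓ₂, hℓ₂, hm₂, fun Q hQ ↦ h Q (hQ.trans (hsum ℓ₂ a))⟩
  · exact ⟨ℓ₃, hℓ₃, hm₃, fun Q hQ ↦ h Q (hQ.trans (hsum ℓ₃ a))⟩

end Summit.BirchSwinnertonDyer.BirchSwinnertonDyer.Theorems.KolyvaginDepthDoor

end
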